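/-
Origin: expansion seat `planner-pub-hodgecm-pv14-g5-0`, handover #2 2026-08-18T09:43:49Z (`HOME/pub-hodgecm-pv14-g5/lean/Pv14g5/PoissonSummationDual.lean`, md5 105d1fb8, 218 lines);
landed by the gen-7 packager in gate run 27 as `HodgeCM/Automorphic/PoissonSummationDual.lean` (import ^import Pv14g5\.→import HodgeCM.Automorphic. ×1).
-/
/-
Origin: HOME/pub-hodgecm-pv14-g5/lean/Pv14g5/PoissonSummationDual.lean — session planner-pub-hodgecm-pv14-g5-0
(unit pub-hodgecm-pv14-g5, DAG-node prover #14 gen 5).  Intended final place: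
`HodgeCM/Automorphic/PoissonSummationDual.lean` (namespace `HodgeCM.PoissonSummation`).
Imports this seat's #1 `PoissonSummationLattice` (PACKAGER: rewrite `import Pv14g5.PoissonSummationLattice` to
`import HodgeCM.Automorphic.PoissonSummationLattice`) and Mathlib only; asserts nothing (no `axiom`, no new
constants).
-/
import Summits.HodgeConjecture.HodgeCM.Automorphic.PoissonSummationLattice_2
import Mathlib.MeasureTheory.Measure.Haar.InnerProductSpace

/-!
# Dual-lattice bookkeeping for Poisson summation: `L** = L`, `covol(L*) · covol(L) = 1`,
the dual-side formula and the self-dual case (KERNEL)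

Complements `PoissonSummationLattice` (d-dimensional Poisson summation
`∑_{v ∈ L} Φ (x + v) = covol(L)⁻¹ ∑_{w ∈ L*} 𝓕 Φ (w) 𝐞 ⟪w, x⟫`) with the facts that make it an involution:

* `dualLattice_dualLattice : dualLattice (dualLattice L) = L`;
* `covolume_dualLattice_mul_covolume : covol(L*) * covol(L) = 1`, `covolume_dualLattice : covol(L*) = covol(L)⁻¹`
  (Gram determinant against an orthonormal basis: `det(dual basis) · det(basis) = det ⟪wᵢ*, wⱼ⟫ = det 1`);
* `fourier_fourier_apply : 𝓕 (𝓕 Φ) y = Φ (-y)` on `𝓢(V, ℂ)` (Mathlib's Fourier inversion);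
* `tsum_dualLattice_fourier : ∑_{w ∈ L*} 𝓕 Φ w = covol(L) · ∑_{v ∈ L} Φ v` and the shifted dual-side formula
  `tsum_dualLattice_fourier_translate : ∑_{w ∈ L*} 𝓕 Φ (x + w) = covol(L) · ∑_{v ∈ L} Φ v · 𝐞 (-⟪v, x⟫)`;
* the self-dual (unimodular) case: `covolume_eq_one_of_dualLattice_eq`,
  `tsum_fourier_eq_tsum_of_dualLattice_eq : L* = L → ∑_{v ∈ L} 𝓕 Φ v = ∑_{v ∈ L} Φ v` — the lattice Dirac comb is
  then exactly `𝓕`-invariant (Weil 1964 n° 41 (39) for the Weyl element, any rank; cf. the `d = 1` leaf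
  `WeilThetaModelPoisson` of pv14-g4).

Everything is a THEOREM over Mathlib (+ `LatticeTheta`, + #1); nothing cited, nothing posited; no statement of
PerL, QW8 or the 2001 programme is used.
-/

set_option autoImplicit false

noncomputable section

open MeasureTheory Module Submodule ZSpan
open scoped RealInnerProductSpace FourierTransform Matrix

namespace HodgeCM
namespace PoissonSummation

section Algebra

variable {V : Type*} [NormedAddCommGroup V] [InnerProductSpace ℝ V] [FiniteDimensional ℝ V]
variable (L : Submodule ℤ V) [DiscreteTopology L] [IsZLattice ℝ L]

omit [FiniteDimensional ℝ V] in
/-- (Ported verbatim from the HodgeCMPerL package; no docstring in the source.) -/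
theorem innerₗ_isSymm : LinearMap.BilinForm.IsSymm (innerₗ V) :=
  ⟨fun x y => real_inner_comm y x⟩

/-- **`L** = L`.** -/
theorem dualLattice_dualLattice : dualLattice (dualLattice L) = L := by
  classical
  let b := Module.Free.chooseBasis ℤ L
  have hL : L = span ℤ (Set.range (realBasis L b)) := (Basis.ofZLatticeBasis_span ℝ L b).symm
  rw [hL]
  exact LinearMap.BilinForm.dualSubmodule_dualSubmodule_of_basis (innerₗ V) innerₗ_nondegenerate
    innerₗ_isSymm (realBasis L b)

omit [FiniteDimensional ℝ V] [DiscreteTopology L] [IsZLattice ℝ L] in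
/-- `L ⊆ L**` elementwise: lattice vectors pair integrally with the dual lattice. -/
theorem le_dualLattice_dualLattice : L ≤ dualLattice (dualLattice L) := by
  intro v hv
  rw [mem_dualLattice]
  intro w hw
  obtain ⟨m, hm⟩ := (mem_dualLattice.mp hw) v hv
  exact ⟨m, by rw [hm, real_inner_comm]⟩

variable {ι : Type*} [Fintype ι] [DecidableEq ι] (b : Basis ι ℤ L)

/-- The Gram identity behind `covol(L*) covol(L) = 1`: against any orthonormal basis `ob`,
`(matrix of the dual basis)ᵀ · (matrix of the basis) = 1`. -/
theorem toMatrix_dualBasis_transpose_mul_toMatrix_realBasis (ob : OrthonormalBasis ι ℝ V) :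
    (ob.toBasis.toMatrix (dualBasis L b))ᵀ * ob.toBasis.toMatrix (realBasis L b) = 1 := by
  ext i j
  rw [Matrix.mul_apply, Matrix.one_apply]
  simp_rw [Matrix.transpose_apply, Basis.toMatrix_apply, OrthonormalBasis.coe_toBasis_repr_apply,
    OrthonormalBasis.repr_apply_apply, real_inner_comm (dualBasis L b i)]
  rw [ob.sum_inner_mul_inner, inner_dualBasis_realBasis]
  rcases eq_or_ne i j with rfl | h
  · simp
  · simp [h, h.symm]

/-- (Ported verbatim from the HodgeCMPerL package; no docstring in the source.) -/
theorem det_dualBasis_mul_det_realBasis (ob : OrthonormalBasis ι ℝ V) :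
    ob.toBasis.det (dualBasis L b) * ob.toBasis.det (realBasis L b) = 1 := by
  rw [Basis.det_apply, Basis.det_apply, ← Matrix.det_transpose (ob.toBasis.toMatrix (dualBasis L b)),
    ← Matrix.det_mul, toMatrix_dualBasis_transpose_mul_toMatrix_realBasis, Matrix.det_one]

end Algebra

section Covolume

variable {V : Type*} [NormedAddCommGroup V] [InnerProductSpace ℝ V] [FiniteDimensional ℝ V]
  [MeasurableSpace V] [BorelSpace V]
variable (L : Submodule ℤ V) [DiscreteTopology L] [IsZLattice ℝ L]

/-- The fundamental domain of an orthonormal basis has volume `1`. -/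
theorem volume_real_fundamentalDomain_orthonormalBasis {ι : Type*} [Fintype ι]
    (ob : OrthonormalBasis ι ℝ V) :
    (volume : Measure V).real (fundamentalDomain ob.toBasis) = 1 := by
  rw [measureReal_congr (fundamentalDomain_ae_parallelepiped ob.toBasis volume), measureReal_def,
    OrthonormalBasis.coe_toBasis, ob.volume_parallelepiped, ENNReal.toReal_one]

/-- With respect to an orthonormal basis indexed like a `ℤ`-basis `b` of `L`,
`covol(L) = |det (realBasis L b)|`. -/
theorem covolume_eq_abs_det_realBasis {ι : Type*} [Fintype ι] [DecidableEq ι] (b : Basis ι ℤ L)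
    (ob : OrthonormalBasis ι ℝ V) :
    ZLattice.covolume L = |ob.toBasis.det (realBasis L b)| := by
  rw [ZLattice.covolume_eq_det_mul_measureReal L volume b ob.toBasis,
    volume_real_fundamentalDomain_orthonormalBasis, mul_one]
  congr 2
  ext i
  simp [realBasis, Basis.ofZLatticeBasis_apply]

/-- … and `covol(L*) = |det (dualBasis L b)|`. -/
theorem covolume_dualLattice_eq_abs_det_dualBasis {ι : Type*} [Fintype ι] [DecidableEq ι]
    (b : Basis ι ℤ L) (ob : OrthonormalBasis ι ℝ V) :
    ZLattice.covolume (dualLattice L) = |ob.toBasis.det (dualBasis L b)| := by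
  rw [ZLattice.covolume_eq_det_mul_measureReal (dualLattice L) volume (dualZBasis L b) ob.toBasis,
    volume_real_fundamentalDomain_orthonormalBasis, mul_one]
  congr 2
  ext i
  simp [coe_dualZBasis]

/-- **`covol(L*) · covol(L) = 1`.** -/
theorem covolume_dualLattice_mul_covolume :
    ZLattice.covolume (dualLattice L) * ZLattice.covolume L = 1 := by
  classical
  let b := Module.Free.chooseBasis ℤ L
  -- an orthonormal basis of `V` indexed by the index type of `b`
  have hcard : Fintype.card (Fin (Module.finrank ℝ V)) =
      Fintype.card (Module.Free.ChooseBasisIndex ℤ L) := by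
    rw [Fintype.card_fin, Module.finrank_eq_card_basis (realBasis L b)]
  let ob : OrthonormalBasis (Module.Free.ChooseBasisIndex ℤ L) ℝ V :=
    (stdOrthonormalBasis ℝ V).reindex (Fintype.equivOfCardEq hcard)
  rw [covolume_dualLattice_eq_abs_det_dualBasis L b ob, covolume_eq_abs_det_realBasis L b ob, ← abs_mul,
    det_dualBasis_mul_det_realBasis, abs_one]

/-- **`covol(L*) = covol(L)⁻¹`.** -/
theorem covolume_dualLattice : ZLattice.covolume (dualLattice L) = (ZLattice.covolume L)⁻¹ :=
  eq_inv_of_mul_eq_one_left (covolume_dualLattice_mul_covolume L)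

/-- Covolume is insensitive to the (`Prop`-valued) lattice instances: equal submodules have equal covolume. -/
theorem covolume_congr {N : Submodule ℤ V} [DiscreteTopology N] [IsZLattice ℝ N] (h : N = L) :
    ZLattice.covolume N = ZLattice.covolume L := by
  subst h
  rfl

/-- A self-dual lattice is unimodular: `L* = L → covol(L) = 1`. -/
theorem covolume_eq_one_of_dualLattice_eq (h : dualLattice L = L) : ZLattice.covolume L = 1 := by
  have h1 := covolume_dualLattice_mul_covolume L
  rw [covolume_congr L h, ← sq] at h1
  have hpos : 0 < ZLattice.covolume L := ZLattice.covolume_pos L volume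
  nlinarith [h1, hpos]

end Covolume

section Fourier

variable {V : Type*} [NormedAddCommGroup V] [InnerProductSpace ℝ V] [FiniteDimensional ℝ V]
  [MeasurableSpace V] [BorelSpace V]
variable (L : Submodule ℤ V) [DiscreteTopology L] [IsZLattice ℝ L]
variable (Φ : SchwartzMap V ℂ)

omit [DiscreteTopology L] [IsZLattice ℝ L] in
/-- Fourier inversion on `𝓢(V, ℂ)`: `𝓕 (𝓕 Φ) (y) = Φ (-y)` (Mathlib's `FourierPair` structure on Schwartz space,
`𝓕⁻ f = (𝓕 f) ∘ neg`). -/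
theorem fourier_fourier_apply (y : V) : (𝓕 (𝓕 Φ)) y = Φ (-y) := by
  have h : (𝓕⁻ (𝓕 Φ)) (-y) = (𝓕 (𝓕 Φ)) y := by
    rw [SchwartzMap.fourierInv_apply_eq]
    simp
  rw [← h, FourierTransform.fourierInv_fourier_eq]

/-- **Dual-side Poisson summation at the origin**: `∑_{w ∈ L*} 𝓕 Φ (w) = covol(L) · ∑_{v ∈ L} Φ (v)`. -/
theorem tsum_dualLattice_fourier :
    ∑' w : dualLattice L, 𝓕 Φ (w : V) = ((ZLattice.covolume L : ℝ) : ℂ) * ∑' v : L, Φ (v : V) := by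
  have hcovol : ((ZLattice.covolume L : ℝ) : ℂ) ≠ 0 := by
    exact_mod_cast (ZLattice.covolume_pos L volume).ne'
  rw [tsum_lattice_eq_tsum_dualLattice_zero L Φ, ← mul_assoc, mul_inv_cancel₀ hcovol, one_mul]

/-- **Dual-side Poisson summation with a shift**:
`∑_{w ∈ L*} 𝓕 Φ (x + w) = covol(L) · ∑_{v ∈ L} Φ (v) 𝐞 (-⟪v, x⟫)` — Poisson summation for the lattice `L*`
(whose dual is `L` and whose covolume is `covol(L)⁻¹`) applied to `𝓕 Φ`, plus Fourier inversion. -/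
theorem tsum_dualLattice_fourier_translate (x : V) :
    ∑' w : dualLattice L, 𝓕 Φ (x + (w : V)) =
      ((ZLattice.covolume L : ℝ) : ℂ) * ∑' v : L, Φ (v : V) * Real.fourierChar (-⟪(v : V), x⟫) := by
  rw [tsum_lattice_eq_tsum_dualLattice (dualLattice L) (𝓕 Φ) x, covolume_dualLattice L,
    Complex.ofReal_inv, inv_inv]
  congr 1
  rw [dualLattice_dualLattice L]
  -- `∑_{u ∈ L} 𝓕𝓕Φ(u) 𝐞⟪u, x⟫ = ∑_{v ∈ L} Φ(v) 𝐞(-⟪v, x⟫)` via `u = -v`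
  rw [← (Equiv.neg L).tsum_eq]
  refine tsum_congr fun v => ?_
  simp only [Equiv.neg_apply, Submodule.coe_neg, fourier_fourier_apply, neg_neg, inner_neg_left]

/-- **Self-dual lattices: the lattice Dirac comb is `𝓕`-invariant**:
`L* = L → ∑_{v ∈ L} 𝓕 Φ (v) = ∑_{v ∈ L} Φ (v)` (Weil 1964 n° 41 (39), Weyl element, any rank). -/
theorem tsum_fourier_eq_tsum_of_dualLattice_eq (h : dualLattice L = L) :
    ∑' v : L, 𝓕 Φ (v : V) = ∑' v : L, Φ (v : V) := by
  have h1 := tsum_dualLattice_fourier L Φ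
  rw [h, covolume_eq_one_of_dualLattice_eq L h, Complex.ofReal_one, one_mul] at h1
  exact h1

/-- Self-dual lattices, shifted form: `L* = L → ∑_{v ∈ L} 𝓕 Φ (x + v) = ∑_{v ∈ L} Φ (v) 𝐞 (-⟪v, x⟫)`. -/
theorem tsum_fourier_translate_eq_of_dualLattice_eq (h : dualLattice L = L) (x : V) :
    ∑' v : L, 𝓕 Φ (x + (v : V)) = ∑' v : L, Φ (v : V) * Real.fourierChar (-⟪(v : V), x⟫) := by
  have h1 := tsum_dualLattice_fourier_translate L Φ x
  rw [h, covolume_eq_one_of_dualLattice_eq L h, Complex.ofReal_one, one_mul] at h1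
  exact h1

end Fourier

end PoissonSummation
end HodgeCM

end
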